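import Mathlib
import Literature.NumberTheory.LFunctions.Zhang2022.TypedSection16ALeaves
import Literature.NumberTheory.Sieve.DivisorBound
import HarnessLib

/-!
# Zhang (2022), typed manuscript, §16 part A — `ℳ₂(d,l;s)` equals its printed Dirichlet series on `σ > 1`

Theorem-only companion of `TypedSection16A` / `TypedSection16ALeaves` (Y. Zhang, arXiv:2211.02515v1
(2022) [Zhang2022LandauSiegel], §16 p.91 — **an unrefereed manuscript under adjudication**; nothing here
asserts its theorems). Node `Z22:§16.u021` (identity part): "the function
`ℳ₂(d,l;s) = ζ(s)L(s,χ)/ζ(s+β₁) · Σ_n λ̃₂(n,d)ξ₂(n;d,l)/n^s` …" — the typed object `calM2` is the Euler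
product `∏'_q calM2Factor`, the printed series is `calM2Series`, and `Step16_u021` claims their equality
for `σ > 1`. This file PROVES it (`step16_u021_holds`):

* majorants (§1): `2^{ω(n)} ≤ τ(n)`, `n ≤ 2^{ω(n)}φ(n)`, `|λ₂(q)| ≤ 3`, `|λ̃₂(n,d)| ≤ τ(n)²`,
  `|κ̃₂(m;r)| ≤ τ(m)²`, `|ξ₂(n;d,l)| ≤ τ(n)⁴`, hence `|λ̃₂(n,d)ξ₂(n;d,l)| ≤ τ(n)⁶ ≤ C n^δ` (divisor
  bound, Hardy–Wright Thm 315 from the tree) and the absolute convergence of `Σ_n λ̃₂ξ₂ n^{−s}`, `σ > 1`;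
* the Euler product of the multiplicative `n ↦ λ̃₂(n,d)ξ₂(n;d,l)` (`step16_u020mult_holds`,
  Mathlib's `EulerProduct.eulerProduct_hasProd`), whose local factor is `1 + λ̃₂(q,d)Σ_{r≥1}ξ₂(qʳ;d,l)q^{−rs}`;
* the Euler products of `ζ(s)`, `L(s,χ)` (Mathlib) and of `1/ζ(s+β₁)` (Möbius), multiplied together
  (`HasProd.mul`).

No definitions, no named facts. [cite: Zhang2022LandauSiegel, §16 p.91 (u021)]

## References
* Y. Zhang, arXiv:2211.02515v1 (2022), §16 pp. 90–92. [cite: Zhang2022LandauSiegel, §16]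
* G. H. Hardy, E. M. Wright, *An Introduction to the Theory of Numbers*, Thm 315 (divisor bound).
  [cite: HardyWright2008, Theorem 315]
-/

noncomputable section

open Complex Real Filter Topology
open Literature.NumberTheory.LFunctions.Zhang2022
open Literature.NumberTheory.LFunctions.Zhang2022.Skeleton
open Literature.NumberTheory.LFunctions.Zhang2022.Typed.Section16A
open Literature.NumberTheory.LFunctions.Zhang2022.Typed.Section16ALeaves

namespace Literature.NumberTheory.LFunctions.Zhang2022.Typed.Section16ACalM2

/-! ## §1. Majorants -/

section Majorants

variable (c' : ℝ) {D : ℕ} (χ : DirichletCharacter ℂ D)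

/-- `2^{ω(n)} ≤ τ(n)` (`n ≥ 1`): `τ(n) = ∏_{p∣n}(v_p(n)+1)` with every factor `≥ 2`. [folklore] -/
private theorem two_pow_card_primeFactors_le_card_divisors {n : ℕ} (hn : n ≠ 0) :
    2 ^ n.primeFactors.card ≤ n.divisors.card := by
  rw [Nat.card_divisors hn]
  refine Finset.pow_card_le_prod _ _ _ fun p hp => ?_
  have : 0 < n.factorization p := Nat.Prime.factorization_pos_of_dvd (Nat.prime_of_mem_primeFactors hp)
    hn (Nat.dvd_of_mem_primeFactors hp)
  omega

/-- `τ(k) ≤ τ(n)` for `k ∣ n`, `n ≥ 1`. [folklore] -/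
private theorem card_divisors_le_of_dvd {k n : ℕ} (hn : n ≠ 0) (hk : k ∣ n) :
    k.divisors.card ≤ n.divisors.card :=
  Finset.card_le_card (Nat.divisors_subset_of_dvd hn hk)

/-- `n ≤ 2^{ω(n)}·φ(n)`: `n/φ(n) = ∏_{p∣n} p/(p−1) ≤ 2^{ω(n)}`. [folklore] -/
private theorem self_le_two_pow_mul_totient (n : ℕ) : n ≤ 2 ^ n.primeFactors.card * Nat.totient n := by
  rcases eq_or_ne n 0 with rfl | hn
  · simp
  have hP : 0 < ∏ p ∈ n.primeFactors, p :=
    Finset.prod_pos fun p hp => (Nat.prime_of_mem_primeFactors hp).pos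
  have key := Nat.totient_mul_prod_primeFactors n
  -- `∏ p ≤ ∏ 2(p-1) = 2^ω ∏ (p-1)`
  have h1 : ∏ p ∈ n.primeFactors, p ≤ 2 ^ n.primeFactors.card * ∏ p ∈ n.primeFactors, (p - 1) := by
    rw [← Finset.prod_const, ← Finset.prod_mul_distrib]
    refine Finset.prod_le_prod' fun p hp => ?_
    have h2 := (Nat.prime_of_mem_primeFactors hp).two_le
    omega
  have h2 : n * ∏ p ∈ n.primeFactors, p ≤ (2 ^ n.primeFactors.card * Nat.totient n) * ∏ p ∈ n.primeFactors, p := by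
    calc n * ∏ p ∈ n.primeFactors, p ≤ n * (2 ^ n.primeFactors.card * ∏ p ∈ n.primeFactors, (p - 1)) :=
          Nat.mul_le_mul_left n h1
      _ = 2 ^ n.primeFactors.card * (n * ∏ p ∈ n.primeFactors, (p - 1)) := by ring
      _ = 2 ^ n.primeFactors.card * (Nat.totient n * ∏ p ∈ n.primeFactors, p) := by rw [key]
      _ = (2 ^ n.primeFactors.card * Nat.totient n) * ∏ p ∈ n.primeFactors, p := by ring
  exact Nat.le_of_mul_le_mul_right h2 hP

/-- `‖q^{−(1+β₁)}‖ = q⁻¹` and `‖q^{−1}‖ = q⁻¹` type facts: `‖q^{−w}‖ = q^{−Re w}`. [folklore] -/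
private theorem norm_natCast_cpow_neg_of_re {q : ℕ} (hq : 0 < q) {w : ℂ} (hw : w.re = 1) :
    ‖(q : ℂ) ^ (-w)‖ = (q : ℝ)⁻¹ := by
  rw [Complex.norm_natCast_cpow_of_pos hq, Complex.neg_re, hw, Real.rpow_neg_one]

/-- `Re β₁ = 0` (`β₁ = ib₁`). [cite: Zhang2022LandauSiegel, §2 (2.13)] -/
private theorem beta1_re (D : ℕ) : (beta1 c' D).re = 0 := by
  rw [beta1_eq_b1_mul_I, Complex.mul_re, Complex.ofReal_re, Complex.ofReal_im, Complex.I_re,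
    Complex.I_im]
  ring

/-- **`|λ₂(q)| ≤ 3`** at a prime `q` (`λ₂(q) = λ₂(q,1) = (1 − χ(q)q^{−1−β₁})/(1 − χ(q)q^{−1})`:
numerator `≤ 3/2`, denominator `≥ 1/2`). [cite: Zhang2022LandauSiegel, §16 p.90 (u014)] -/
theorem norm_lam2_prime_one_le [NeZero D] {q : ℕ} (hq : q.Prime) : ‖lam2 c' χ q 1‖ ≤ 3 := by
  rw [lam2_prime c' χ hq]
  have hq2 : (2 : ℝ) ≤ q := by exact_mod_cast hq.two_le
  have hqinv : (q : ℝ)⁻¹ ≤ 1 / 2 := by rw [inv_eq_one_div]; exact one_div_le_one_div_of_le two_pos hq2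
  have hχ : ‖χ (q : ZMod D)‖ ≤ 1 := DirichletCharacter.norm_le_one χ _
  have hnum : ‖1 - χ (q : ZMod D) * (q : ℂ) ^ (-((1 : ℂ) + beta1 c' D))‖ ≤ 3 / 2 := by
    have hre : ((1 : ℂ) + beta1 c' D).re = 1 := by rw [Complex.add_re, beta1_re, Complex.one_re]; ring
    calc ‖1 - χ (q : ZMod D) * (q : ℂ) ^ (-((1 : ℂ) + beta1 c' D))‖
        ≤ ‖(1 : ℂ)‖ + ‖χ (q : ZMod D) * (q : ℂ) ^ (-((1 : ℂ) + beta1 c' D))‖ := norm_sub_le _ _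
      _ = 1 + ‖χ (q : ZMod D)‖ * (q : ℝ)⁻¹ := by
          rw [norm_one, norm_mul, norm_natCast_cpow_neg_of_re hq.pos hre]
      _ ≤ 1 + 1 * (1 / 2) := by gcongr
      _ = 3 / 2 := by norm_num
  have hden : (1 : ℝ) / 2 ≤ ‖1 - χ (q : ZMod D) * (q : ℂ) ^ (-(1 : ℂ))‖ := by
    have h1 : ‖χ (q : ZMod D) * (q : ℂ) ^ (-(1 : ℂ))‖ ≤ 1 / 2 := by
      rw [norm_mul, norm_natCast_cpow_neg_of_re hq.pos Complex.one_re]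
      calc ‖χ (q : ZMod D)‖ * (q : ℝ)⁻¹ ≤ 1 * (1 / 2) := by gcongr
        _ = 1 / 2 := one_mul _
    have := norm_sub_norm_le (1 : ℂ) (χ (q : ZMod D) * (q : ℂ) ^ (-(1 : ℂ)))
    rw [norm_one] at this
    linarith
  have hden0 : 0 < ‖1 - χ (q : ZMod D) * (q : ℂ) ^ (-(1 : ℂ))‖ := lt_of_lt_of_le (by norm_num) hden
  rw [norm_div, div_le_iff₀ hden0]
  linarith

/-- **`|λ̃₂(n,d)| ≤ 3^{ω(n)}`** (a product of `|λ₂(q)| ≤ 3` over some of the primes of `n`).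
[cite: Zhang2022LandauSiegel, §16 (16.8) p.91] -/
theorem norm_lamTilde2_le_three_pow [NeZero D] (n d : ℕ) :
    ‖lamTilde2 c' χ n d‖ ≤ 3 ^ n.primeFactors.card := by
  unfold lamTilde2
  rw [norm_prod]
  calc ∏ q ∈ n.primeFactors.filter (fun q => Nat.Coprime q d), ‖lam2 c' χ q 1‖
      ≤ ∏ _q ∈ n.primeFactors.filter (fun q => Nat.Coprime q d), (3 : ℝ) :=
        Finset.prod_le_prod (fun _ _ => norm_nonneg _) fun q hq =>
          norm_lam2_prime_one_le c' χ (Nat.prime_of_mem_primeFactors (Finset.mem_filter.mp hq).1)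
    _ = 3 ^ (n.primeFactors.filter (fun q => Nat.Coprime q d)).card := Finset.prod_const 3
    _ ≤ 3 ^ n.primeFactors.card :=
        pow_le_pow_right₀ (by norm_num) (Finset.card_filter_le _ _)

/-- `|λ̃₂(n,d)| ≤ τ(n)²` (`n ≥ 1`; `3^{ω} ≤ 4^{ω} = (2^{ω})² ≤ τ(n)²`). [cite: Zhang2022LandauSiegel, §16 (16.8) p.91] -/
theorem norm_lamTilde2_le [NeZero D] {n : ℕ} (hn : n ≠ 0) (d : ℕ) :
    ‖lamTilde2 c' χ n d‖ ≤ (n.divisors.card : ℝ) ^ 2 := by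
  have h1 := norm_lamTilde2_le_three_pow c' χ n d
  have h2 : (3 : ℝ) ^ n.primeFactors.card ≤ (4 : ℝ) ^ n.primeFactors.card :=
    pow_le_pow_left₀ (by norm_num) (by norm_num) _
  have h3 : (4 : ℝ) ^ n.primeFactors.card = ((2 : ℝ) ^ n.primeFactors.card) ^ 2 := by
    rw [← pow_mul, mul_comm, pow_mul]; norm_num
  have h4 : (2 : ℝ) ^ n.primeFactors.card ≤ n.divisors.card := by
    exact_mod_cast two_pow_card_primeFactors_le_card_divisors hn
  calc ‖lamTilde2 c' χ n d‖ ≤ (4 : ℝ) ^ n.primeFactors.card := h1.trans h2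
    _ = ((2 : ℝ) ^ n.primeFactors.card) ^ 2 := h3
    _ ≤ (n.divisors.card : ℝ) ^ 2 := pow_le_pow_left₀ (by positivity) h4 2

/-- `𝔫(m)` (`m ≥ 1`) is the set of `m.primeFactors`-factored numbers. [folklore] -/
private theorem mem_nset_iff_factoredNumbers {m h : ℕ} (hm : m ≠ 0) :
    h ∈ nset m ↔ h ∈ Nat.factoredNumbers m.primeFactors := by
  rw [Nat.mem_factoredNumbers_iff_primeFactors_subset]
  constructor
  · rintro ⟨hpos, hdiv⟩
    refine ⟨hpos.ne', fun q hq => ?_⟩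
    have hq' := Nat.mem_primeFactors.mp hq
    exact Nat.mem_primeFactors.mpr ⟨hq'.1, hdiv q hq'.1 hq'.2.1, hm⟩
  · rintro ⟨h0, hsub⟩
    refine ⟨Nat.pos_of_ne_zero h0, fun q hq hqh => ?_⟩
    exact (Nat.mem_primeFactors.mp (hsub (Nat.mem_primeFactors.mpr ⟨hq, hqh, h0⟩))).2.1

/-- `|κ₂(N)| ≤ 2^{ω(N)}` (`N ≥ 1`). [cite: Zhang2022LandauSiegel, App. A p.105] -/
private theorem norm_kappa2_le_two_pow (D : ℕ) {N : ℕ} (hN : N ≠ 0) :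
    ‖kappa2 c' D N‖ ≤ 2 ^ N.primeFactors.card := by
  have hmul := MeanSquareMajorant.isMultiplicative_kappa₂ (b1 c' D)
  unfold kappa2
  rw [hmul.multiplicative_factorization _ hN, Finsupp.prod, Nat.support_factorization, norm_prod]
  calc ∏ p ∈ N.primeFactors, ‖MeanSquareMajorant.kappa₂ (b1 c' D) (p ^ N.factorization p)‖
      ≤ ∏ _p ∈ N.primeFactors, (2 : ℝ) :=
        Finset.prod_le_prod (fun _ _ => norm_nonneg _) fun p hp =>
          AppendixA.norm_kappa₂_prime_pow_le_two _ (Nat.prime_of_mem_primeFactors hp) _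
    _ = 2 ^ N.primeFactors.card := Finset.prod_const 2

/-- **`Σ_{h∈𝔫(m)} 1/h ≤ 2^{ω(m)}`** (`= ∏_{q∣m}(1 − 1/q)⁻¹`, each factor `≤ 2`), as a `HasSum` over `ℕ` of
the indicator. [folklore] -/
private theorem hasSum_nset_inv_le (m : ℕ) :
    ∃ S : ℝ, S ≤ 2 ^ m.primeFactors.card ∧
      HasSum ((Nat.factoredNumbers m.primeFactors).indicator fun h : ℕ => (h : ℝ)⁻¹) S := by
  let f : ℕ →* ℝ :=
    { toFun := fun n => (n : ℝ)⁻¹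
      map_one' := by simp
      map_mul' := fun a b => by push_cast; rw [mul_inv] }
  have hf : ∀ n : ℕ, f n = (n : ℝ)⁻¹ := fun n => rfl
  have hlt : ∀ {p : ℕ}, p.Prime → ‖f p‖ < 1 := by
    intro p hp
    rw [hf, Real.norm_eq_abs, abs_of_nonneg (by positivity)]
    exact inv_lt_one_of_one_lt₀ (by exact_mod_cast hp.one_lt)
  obtain ⟨-, hsum⟩ :=
    EulerProduct.summable_and_hasSum_factoredNumbers_prod_filter_prime_geometric hlt m.primeFactors
  refine ⟨_, ?_, hasSum_subtype_iff_indicator.mp hsum⟩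
  have hfilter : m.primeFactors.filter (fun p => p.Prime) = m.primeFactors :=
    Finset.filter_true_of_mem fun p hp => Nat.prime_of_mem_primeFactors hp
  rw [hfilter, ← Finset.prod_const]
  refine Finset.prod_le_prod (fun p hp => ?_) fun p hp => ?_
  · have h1 := (hlt (Nat.prime_of_mem_primeFactors hp)).le
    rw [Real.norm_eq_abs, abs_of_nonneg (by rw [hf]; positivity)] at h1
    exact inv_nonneg.mpr (by linarith)
  · have hp2 : (2 : ℝ) ≤ p := by exact_mod_cast (Nat.prime_of_mem_primeFactors hp).two_le
    have h12 : f p ≤ 1 / 2 := by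
      rw [hf, inv_eq_one_div]; exact one_div_le_one_div_of_le two_pos hp2
    calc (1 - f p)⁻¹ ≤ (1 - 1 / 2)⁻¹ := by
          apply inv_anti₀ (by norm_num); linarith
      _ = 2 := by norm_num

open scoped Classical in
/-- **`|κ̃₂(m;r)| ≤ 4^{ω(m)}`** (`m ≥ 1`, at `s = 1`): termwise `|κ₂(mh)χ(h)/h| ≤ 2^{ω(m)}/h` on `𝔫(m)` and
`Σ_{h∈𝔫(m)} 1/h ≤ 2^{ω(m)}`. [cite: Zhang2022LandauSiegel, §16 p.90 (u013)] -/
theorem norm_kappaTilde2_one_le_four_pow [NeZero D] {m : ℕ} (hm : m ≠ 0) (r : ℕ) :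
    ‖kappaTilde2 c' χ m r 1‖ ≤ 4 ^ m.primeFactors.card := by
  obtain ⟨S, hS, hsum⟩ := hasSum_nset_inv_le m
  set g : ℕ → ℝ := fun h => 2 ^ m.primeFactors.card *
    (Nat.factoredNumbers m.primeFactors).indicator (fun h : ℕ => (h : ℝ)⁻¹) h with hg
  have hgsum : HasSum g (2 ^ m.primeFactors.card * S) := hsum.mul_left _
  have hbound : ∀ h : ℕ, ‖(if h ∈ nset m ∧ Nat.Coprime h r then
      kappa2 c' D (m * h) * χ (h : ZMod D) / (h : ℂ) ^ (1 : ℂ) else 0)‖ ≤ g h := by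
    intro h
    by_cases hc : h ∈ nset m ∧ Nat.Coprime h r
    · rw [if_pos hc]
      have hh0 : 0 < h := hc.1.1
      have hmem : h ∈ Nat.factoredNumbers m.primeFactors := (mem_nset_iff_factoredNumbers hm).mp hc.1
      rw [hg]
      simp only [Set.indicator_of_mem hmem]
      rw [Complex.cpow_one, norm_div, norm_mul, Complex.norm_natCast]
      have hκ : ‖kappa2 c' D (m * h)‖ ≤ 2 ^ m.primeFactors.card := by
        have h1 := norm_kappa2_le_two_pow c' D (mul_ne_zero hm hh0.ne')
        have hpf : (m * h).primeFactors = m.primeFactors := by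
          rw [Nat.primeFactors_mul hm hh0.ne', Finset.union_eq_left]
          intro q hq
          have hq' := Nat.mem_primeFactors.mp hq
          exact Nat.mem_primeFactors.mpr ⟨hq'.1, hc.1.2 q hq'.1 hq'.2.1, hm⟩
        rwa [hpf] at h1
      have hχ : ‖χ (h : ZMod D)‖ ≤ 1 := DirichletCharacter.norm_le_one χ _
      rw [div_eq_mul_inv]
      calc ‖kappa2 c' D (m * h)‖ * ‖χ (h : ZMod D)‖ * (h : ℝ)⁻¹
          ≤ 2 ^ m.primeFactors.card * 1 * (h : ℝ)⁻¹ := by gcongr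
        _ = 2 ^ m.primeFactors.card * (h : ℝ)⁻¹ := by rw [mul_one]
    · rw [if_neg hc, norm_zero, hg]
      exact mul_nonneg (by positivity) (Set.indicator_nonneg (fun _ _ => by positivity) _)
  have key := tsum_of_norm_bounded hgsum hbound
  unfold kappaTilde2
  refine key.trans ?_
  calc (2 : ℝ) ^ m.primeFactors.card * S ≤ 2 ^ m.primeFactors.card * 2 ^ m.primeFactors.card := by
        gcongr
    _ = 4 ^ m.primeFactors.card := by rw [← mul_pow]; norm_num

/-- `|κ̃₂(m;r)| ≤ τ(m)²` (`m ≥ 1`). [cite: Zhang2022LandauSiegel, §16 p.90 (u013)] -/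
theorem norm_kappaTilde2_one_le [NeZero D] {m : ℕ} (hm : m ≠ 0) (r : ℕ) :
    ‖kappaTilde2 c' χ m r 1‖ ≤ (m.divisors.card : ℝ) ^ 2 := by
  have h1 := norm_kappaTilde2_one_le_four_pow c' χ hm r
  have h3 : (4 : ℝ) ^ m.primeFactors.card = ((2 : ℝ) ^ m.primeFactors.card) ^ 2 := by
    rw [← pow_mul, mul_comm, pow_mul]; norm_num
  have h4 : (2 : ℝ) ^ m.primeFactors.card ≤ m.divisors.card := by
    exact_mod_cast two_pow_card_primeFactors_le_card_divisors hm
  calc ‖kappaTilde2 c' χ m r 1‖ ≤ (4 : ℝ) ^ m.primeFactors.card := h1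
    _ = ((2 : ℝ) ^ m.primeFactors.card) ^ 2 := h3
    _ ≤ (m.divisors.card : ℝ) ^ 2 := pow_le_pow_left₀ (by positivity) h4 2

/-- The weight of (16.7): `‖μ(k)χ(k)k/φ(k)‖ ≤ 2^{ω(k)} ≤ τ(k)` (`k ≥ 1`). [cite: Zhang2022LandauSiegel, §16 (16.7) p.91] -/
theorem norm_moebChi_weight_le {k : ℕ} (hk : k ≠ 0) :
    ‖(ArithmeticFunction.moebius k : ℂ) * χ (k : ZMod D) * (k : ℂ) / (Nat.totient k : ℂ)‖ ≤
      (k.divisors.card : ℝ) := by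
  have hφ : 0 < Nat.totient k := Nat.totient_pos.mpr (Nat.pos_of_ne_zero hk)
  have hφR : (0 : ℝ) < Nat.totient k := by exact_mod_cast hφ
  have hμ : ‖(ArithmeticFunction.moebius k : ℂ)‖ ≤ 1 := by
    rw [Complex.norm_intCast]
    exact_mod_cast ArithmeticFunction.abs_moebius_le_one
  have hχ : ‖χ (k : ZMod D)‖ ≤ 1 := DirichletCharacter.norm_le_one χ _
  have hkφ : (k : ℝ) ≤ 2 ^ k.primeFactors.card * Nat.totient k := by
    exact_mod_cast self_le_two_pow_mul_totient k
  have h2 : (2 : ℝ) ^ k.primeFactors.card ≤ k.divisors.card := by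
    exact_mod_cast two_pow_card_primeFactors_le_card_divisors hk
  rw [norm_div, norm_mul, norm_mul, Complex.norm_natCast, Complex.norm_natCast, div_le_iff₀ hφR]
  calc ‖(ArithmeticFunction.moebius k : ℂ)‖ * ‖χ (k : ZMod D)‖ * (k : ℝ) ≤ 1 * 1 * (k : ℝ) := by
        gcongr
    _ = k := by ring
    _ ≤ 2 ^ k.primeFactors.card * Nat.totient k := hkφ
    _ ≤ (k.divisors.card : ℝ) * Nat.totient k := by gcongr

/-- **`|ξ₂(n;d,l)| ≤ τ(n)⁴`** (`n ≥ 1`): at most `τ(n)` divisors `k`, each contributing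
`≤ τ(k)·τ(n/k)² ≤ τ(n)³`. [cite: Zhang2022LandauSiegel, §16 (16.7) p.91] -/
theorem norm_xi2_le [NeZero D] {n : ℕ} (hn : n ≠ 0) (d l : ℕ) :
    ‖xi2 c' χ n d l‖ ≤ (n.divisors.card : ℝ) ^ 4 := by
  unfold xi2
  have hτ : ∀ k ∈ n.divisors.filter (fun k => Nat.Coprime k l),
      ‖(ArithmeticFunction.moebius k : ℂ) * χ (k : ZMod D) * (k : ℂ) / (Nat.totient k : ℂ) *
        kappaTilde2 c' χ (n / k) (d * k) 1‖ ≤ (n.divisors.card : ℝ) ^ 3 := by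
    intro k hk
    have hkn : k ∣ n := (Nat.mem_divisors.mp (Finset.mem_filter.mp hk).1).1
    have hk0 : k ≠ 0 := (Nat.pos_of_dvd_of_pos hkn (Nat.pos_of_ne_zero hn)).ne'
    have hq0 : n / k ≠ 0 := (Nat.div_pos (Nat.le_of_dvd (Nat.pos_of_ne_zero hn) hkn)
      (Nat.pos_of_ne_zero hk0)).ne'
    have h1 := norm_moebChi_weight_le χ hk0
    have h2 := norm_kappaTilde2_one_le c' χ hq0 (d * k)
    have hτk : (k.divisors.card : ℝ) ≤ n.divisors.card := by
      exact_mod_cast card_divisors_le_of_dvd hn hkn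
    have hτq : ((n / k).divisors.card : ℝ) ≤ n.divisors.card := by
      exact_mod_cast card_divisors_le_of_dvd hn (Nat.div_dvd_of_dvd hkn)
    rw [norm_mul]
    calc ‖(ArithmeticFunction.moebius k : ℂ) * χ (k : ZMod D) * (k : ℂ) / (Nat.totient k : ℂ)‖ *
          ‖kappaTilde2 c' χ (n / k) (d * k) 1‖
        ≤ (k.divisors.card : ℝ) * ((n / k).divisors.card : ℝ) ^ 2 :=
          mul_le_mul h1 h2 (norm_nonneg _) (Nat.cast_nonneg _)
      _ ≤ (n.divisors.card : ℝ) * (n.divisors.card : ℝ) ^ 2 := by gcongr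
      _ = (n.divisors.card : ℝ) ^ 3 := by ring
  calc ‖∑ k ∈ n.divisors.filter (fun k => Nat.Coprime k l),
        (ArithmeticFunction.moebius k : ℂ) * χ (k : ZMod D) * (k : ℂ) / (Nat.totient k : ℂ) *
          kappaTilde2 c' χ (n / k) (d * k) 1‖
      ≤ ∑ k ∈ n.divisors.filter (fun k => Nat.Coprime k l),
          ‖(ArithmeticFunction.moebius k : ℂ) * χ (k : ZMod D) * (k : ℂ) / (Nat.totient k : ℂ) *
            kappaTilde2 c' χ (n / k) (d * k) 1‖ := norm_sum_le _ _
    _ ≤ ∑ _k ∈ n.divisors.filter (fun k => Nat.Coprime k l), (n.divisors.card : ℝ) ^ 3 :=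
        Finset.sum_le_sum hτ
    _ = ((n.divisors.filter (fun k => Nat.Coprime k l)).card : ℝ) * (n.divisors.card : ℝ) ^ 3 := by
        rw [Finset.sum_const, nsmul_eq_mul]
    _ ≤ (n.divisors.card : ℝ) * (n.divisors.card : ℝ) ^ 3 := by
        gcongr
        exact Finset.filter_subset _ _
    _ = (n.divisors.card : ℝ) ^ 4 := by ring

/-- **`|λ̃₂(n,d)ξ₂(n;d,l)| ≤ τ(n)⁶`** (`n ≥ 1`). [cite: Zhang2022LandauSiegel, §16 p.91 (u021)] -/
theorem norm_lamTilde2_mul_xi2_le [NeZero D] {n : ℕ} (hn : n ≠ 0) (d l : ℕ) :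
    ‖lamTilde2 c' χ n d * xi2 c' χ n d l‖ ≤ (n.divisors.card : ℝ) ^ 6 := by
  rw [norm_mul]
  calc ‖lamTilde2 c' χ n d‖ * ‖xi2 c' χ n d l‖ ≤ (n.divisors.card : ℝ) ^ 2 * (n.divisors.card : ℝ) ^ 4 :=
        mul_le_mul (norm_lamTilde2_le c' χ hn d) (norm_xi2_le c' χ hn d l) (norm_nonneg _) (by positivity)
    _ = (n.divisors.card : ℝ) ^ 6 := by ring

/-- **Absolute convergence of `Σ_n λ̃₂(n,d)ξ₂(n;d,l)n^{−s}` for `σ > 1`**: with `δ = (σ−1)/2` and the divisor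
bound `τ(n) ≤ C n^{δ/6}` (Hardy–Wright Thm 315, `Sieve.exists_card_divisors_le_mul_rpow`) the terms are
`≤ C⁶ n^{δ−σ}`, `δ − σ < −1`. [cite: Zhang2022LandauSiegel, §16 p.91 (u021)] -/
theorem lseriesSummable_lamTilde2_mul_xi2 [NeZero D] (d l : ℕ) {s : ℂ} (hs : 1 < s.re) :
    LSeriesSummable (fun n => lamTilde2 c' χ n d * xi2 c' χ n d l) s := by
  set δ : ℝ := (s.re - 1) / 2 with hδ
  have hδ0 : 0 < δ := by rw [hδ]; linarith
  obtain ⟨C, hC1, hC⟩ := Literature.NumberTheory.Sieve.exists_card_divisors_le_mul_rpow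
    (show 0 < δ / 6 by positivity)
  have hC0 : 0 ≤ C := zero_le_one.trans hC1
  -- majorant `C⁶ n^{δ - σ}`, summable since `δ - σ < -1`
  have hexp : δ - s.re < -1 := by rw [hδ]; linarith
  have hmaj : Summable fun n : ℕ => C ^ 6 * (n : ℝ) ^ (δ - s.re) :=
    (Real.summable_nat_rpow.mpr hexp).mul_left _
  refine Summable.of_norm_bounded hmaj fun n => ?_
  rcases eq_or_ne n 0 with rfl | hn
  · simp only [LSeries.term_zero, norm_zero, Nat.cast_zero]
    exact mul_nonneg (pow_nonneg hC0 6) (Real.rpow_nonneg le_rfl _)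
  have hnR : (0 : ℝ) < n := by exact_mod_cast Nat.pos_of_ne_zero hn
  rw [LSeries.term_of_ne_zero hn, norm_div, Complex.norm_natCast_cpow_of_pos (Nat.pos_of_ne_zero hn),
    div_le_iff₀ (Real.rpow_pos_of_pos hnR _)]
  have hτ : (n.divisors.card : ℝ) ≤ C * (n : ℝ) ^ (δ / 6) := hC n hn
  have hτ6 : (n.divisors.card : ℝ) ^ 6 ≤ (C * (n : ℝ) ^ (δ / 6)) ^ 6 :=
    pow_le_pow_left₀ (Nat.cast_nonneg _) hτ 6
  calc ‖lamTilde2 c' χ n d * xi2 c' χ n d l‖ ≤ (n.divisors.card : ℝ) ^ 6 :=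
        norm_lamTilde2_mul_xi2_le c' χ hn d l
    _ ≤ (C * (n : ℝ) ^ (δ / 6)) ^ 6 := hτ6
    _ = C ^ 6 * (n : ℝ) ^ δ := by
        rw [mul_pow, ← Real.rpow_natCast ((n : ℝ) ^ (δ / 6)) 6, ← Real.rpow_mul hnR.le]
        congr 2; ring
    _ = C ^ 6 * (n : ℝ) ^ (δ - s.re) * (n : ℝ) ^ s.re := by
        rw [mul_assoc, ← Real.rpow_add hnR]; congr 2; ring

end Majorants

/-! ## §2. Euler products and the identity `ℳ₂ = calM2Series` on `σ > 1` -/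

section EulerM2

open scoped LSeries.notation
open LSeries (term)

variable (c' : ℝ) {D : ℕ} (χ : DirichletCharacter ℂ D)

/-- `(q^e)^s = (q^s)^e` for naturals `q, e` and complex `s`. [folklore] -/
private theorem natCast_pow_cpow (q e : ℕ) (s : ℂ) : ((q ^ e : ℕ) : ℂ) ^ s = ((q : ℂ) ^ s) ^ e := by
  induction e with
  | zero => simp
  | succ e ih => rw [pow_succ, Nat.cast_mul, Complex.natCast_mul_natCast_cpow, ih, pow_succ]

/-! ### `λ̃₂(·,d)`: value at `1`, multiplicativity, prime powers -/

/-- `λ̃₂(1,d) = 1`. [cite: Zhang2022LandauSiegel, §16 (16.8) p.91] -/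
theorem lamTilde2_one [NeZero D] (d : ℕ) : lamTilde2 c' χ 1 d = 1 := by
  unfold lamTilde2; simp

/-- `λ̃₂(mn,d) = λ̃₂(m,d)λ̃₂(n,d)` for coprime `m, n` (disjoint prime factors). [cite: Zhang2022LandauSiegel, §16 (16.8) p.91] -/
theorem lamTilde2_mul_of_coprime [NeZero D] {m n : ℕ} (hmn : Nat.Coprime m n) (d : ℕ) :
    lamTilde2 c' χ (m * n) d = lamTilde2 c' χ m d * lamTilde2 c' χ n d := by
  unfold lamTilde2
  rw [Nat.Coprime.primeFactors_mul hmn, Finset.filter_union,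
    Finset.prod_union (Finset.disjoint_filter_filter hmn.disjoint_primeFactors)]

/-- `λ̃₂(qᵉ,d) = λ̃₂(q,d)` (`q` prime, `e ≥ 1`). [cite: Zhang2022LandauSiegel, §16 (16.8) p.91] -/
theorem lamTilde2_prime_pow [NeZero D] {q e : ℕ} (hq : q.Prime) (he : e ≠ 0) (d : ℕ) :
    lamTilde2 c' χ (q ^ e) d = lamTilde2 c' χ q d := by
  unfold lamTilde2
  rw [Nat.primeFactors_prime_pow he hq, hq.primeFactors]

/-- `ξ₂(0;d,l) = 0` (junk value). [folklore] -/
private theorem xi2_zero [NeZero D] (d l : ℕ) : xi2 c' χ 0 d l = 0 := by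
  unfold xi2; simp

/-! ### The Euler product of `n ↦ λ̃₂(n,d)ξ₂(n;d,l)n^{−s}` -/

/-- The `L`-series term of `λ̃₂ξ₂` at `1` is `1`. [cite: Zhang2022LandauSiegel, §16 p.91 (u020, u021)] -/
private theorem termG_one [NeZero D] (d l : ℕ) (s : ℂ) :
    term (fun n => lamTilde2 c' χ n d * xi2 c' χ n d l) s 1 = 1 := by
  rw [LSeries.term_of_ne_zero one_ne_zero, lamTilde2_one, xi2_one, Nat.cast_one, Complex.one_cpow]
  norm_num

/-- The `L`-series terms of `λ̃₂ξ₂` are multiplicative on coprime arguments (`λ̃₂(·,d)` by disjointness of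
prime factors, `ξ₂(·;d,l)` by `xi2_mul_of_coprime`). [cite: Zhang2022LandauSiegel, §16 p.91 (u020)] -/
private theorem termG_mul_of_coprime [NeZero D] (d l : ℕ) (s : ℂ) {m n : ℕ} (hmn : Nat.Coprime m n) :
    term (fun k => lamTilde2 c' χ k d * xi2 c' χ k d l) s (m * n) =
      term (fun k => lamTilde2 c' χ k d * xi2 c' χ k d l) s m *
        term (fun k => lamTilde2 c' χ k d * xi2 c' χ k d l) s n := by
  rcases eq_or_ne m 0 with rfl | hm
  · simp
  rcases eq_or_ne n 0 with rfl | hn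
  · simp
  rw [LSeries.term_of_ne_zero (mul_ne_zero hm hn), LSeries.term_of_ne_zero hm,
    LSeries.term_of_ne_zero hn, lamTilde2_mul_of_coprime c' χ hmn, xi2_mul_of_coprime c' χ d l hmn,
    Nat.cast_mul, Complex.natCast_mul_natCast_cpow, div_mul_div_comm]
  ring

/-- **Euler product of `Σ_n λ̃₂(n,d)ξ₂(n;d,l)n^{−s}`** (`σ > 1`):
`HasProd (q ↦ Σ_e λ̃₂(qᵉ,d)ξ₂(qᵉ;d,l)q^{−es}) (Σ_n λ̃₂ξ₂n^{−s})`. [cite: Zhang2022LandauSiegel, §16 p.91 (u021)] -/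
theorem hasProd_lamTilde2_xi2 [NeZero D] (d l : ℕ) {s : ℂ} (hs : 1 < s.re) :
    HasProd (fun q : Nat.Primes => ∑' e : ℕ, term (fun n => lamTilde2 c' χ n d * xi2 c' χ n d l) s (q ^ e))
      (∑' n : ℕ, term (fun n => lamTilde2 c' χ n d * xi2 c' χ n d l) s n) :=
  EulerProduct.eulerProduct_hasProd (termG_one c' χ d l s) (fun hmn => termG_mul_of_coprime c' χ d l s hmn)
    (lseriesSummable_lamTilde2_mul_xi2 c' χ d l hs).norm (LSeries.term_zero _ _)

/-- **The local factor**: `Σ_e λ̃₂(qᵉ,d)ξ₂(qᵉ;d,l)q^{−es} = 1 + λ̃₂(q,d)·Σ_{r≥1} ξ₂(qʳ;d,l)q^{−rs}`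
(`λ̃₂(qʳ,d) = λ̃₂(q,d)` for `r ≥ 1`; the shape of the typed `calM2Factor`). [cite: Zhang2022LandauSiegel, §16 p.92 (u026)] -/
theorem tsum_termG_prime_pow [NeZero D] (d l : ℕ) {s : ℂ} (hs : 1 < s.re) {q : ℕ} (hq : q.Prime) :
    ∑' e : ℕ, term (fun n => lamTilde2 c' χ n d * xi2 c' χ n d l) s (q ^ e) =
      1 + lamTilde2 c' χ q d * xi2LocalSeries c' χ q d l s := by
  set G : ℕ → ℂ := fun e => term (fun n => lamTilde2 c' χ n d * xi2 c' χ n d l) s (q ^ e) with hG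
  have hGsum : Summable G :=
    (lseriesSummable_lamTilde2_mul_xi2 c' χ d l hs).comp_injective (Nat.pow_right_injective hq.two_le)
  -- split `G e = a e + λ̃₂(q,d) b e`
  set a : ℕ → ℂ := fun e => if e = 0 then 1 else 0 with ha
  set b : ℕ → ℂ := fun e => if e = 0 then 0 else xi2 c' χ (q ^ e) d l / (q : ℂ) ^ ((e : ℂ) * s) with hb
  have hGe : ∀ e, G e = a e + lamTilde2 c' χ q d * b e := by
    intro e
    rcases eq_or_ne e 0 with rfl | he
    · simp only [hG, ha, hb, if_true, pow_zero, mul_zero, add_zero]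
      exact termG_one c' χ d l s
    · simp only [hG, ha, hb, if_neg he, zero_add]
      rw [LSeries.term_of_ne_zero (pow_ne_zero e hq.ne_zero), lamTilde2_prime_pow c' χ hq he,
        natCast_pow_cpow, Complex.cpow_nat_mul]
      ring
  have hasum : HasSum a 1 := hasSum_ite_eq 0 1
  have hGfun : G = fun e => a e + lamTilde2 c' χ q d * b e := funext hGe
  by_cases hlam : lamTilde2 c' χ q d = 0
  · -- then `G = a` and both sides are `1`
    have hGa : G = a := by
      rw [hGfun]; funext e; rw [hlam, zero_mul, add_zero]
    rw [hGa, hasum.tsum_eq, hlam, zero_mul, add_zero]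
  · have hbsum : Summable b := by
      have hb' : b = fun e => (lamTilde2 c' χ q d)⁻¹ * (G e - a e) := by
        funext e; rw [hGe e]; field_simp; ring
      rw [hb']
      exact (hGsum.sub hasum.summable).mul_left _
    rw [hGfun, hasum.summable.tsum_add (hbsum.mul_left _), hasum.tsum_eq, tsum_mul_left]
    simp only [hb, xi2LocalSeries]

/-! ### The Euler products of `ζ(s)`, `L(s,χ)` (Mathlib) and of `1/ζ(s+β₁)` (Möbius) -/

/-- The `L`-series term of `μ` at `1`. [folklore] -/
private theorem term_moebius_one (w : ℂ) :
    term (fun n : ℕ => ((ArithmeticFunction.moebius n : ℤ) : ℂ)) w 1 = 1 := by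
  rw [LSeries.term_of_ne_zero one_ne_zero, ArithmeticFunction.moebius_apply_one, Int.cast_one,
    Nat.cast_one, Complex.one_cpow, div_one]

/-- The `L`-series terms of `μ` are multiplicative on coprime arguments. [folklore] -/
private theorem term_moebius_mul_of_coprime (w : ℂ) {m n : ℕ} (hmn : Nat.Coprime m n) :
    term (fun k : ℕ => ((ArithmeticFunction.moebius k : ℤ) : ℂ)) w (m * n) =
      term (fun k : ℕ => ((ArithmeticFunction.moebius k : ℤ) : ℂ)) w m *
        term (fun k : ℕ => ((ArithmeticFunction.moebius k : ℤ) : ℂ)) w n := by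
  rcases eq_or_ne m 0 with rfl | hm
  · simp
  rcases eq_or_ne n 0 with rfl | hn
  · simp
  rw [LSeries.term_of_ne_zero (mul_ne_zero hm hn), LSeries.term_of_ne_zero hm,
    LSeries.term_of_ne_zero hn, ArithmeticFunction.isMultiplicative_moebius.map_mul_of_coprime hmn,
    Int.cast_mul, Nat.cast_mul, Complex.natCast_mul_natCast_cpow, div_mul_div_comm]

/-- The Euler factor of `Σ μ(n)n^{−w}` at `p`: `Σ_e μ(pᵉ)p^{−ew} = 1 − p^{−w}`. [folklore] -/
private theorem tsum_term_moebius_prime_pow (w : ℂ) {p : ℕ} (hp : p.Prime) :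
    ∑' e : ℕ, term (fun k : ℕ => ((ArithmeticFunction.moebius k : ℤ) : ℂ)) w (p ^ e) =
      1 - (p : ℂ) ^ (-w) := by
  rw [tsum_eq_sum (s := Finset.range 2)]
  · rw [Finset.sum_range_succ, Finset.sum_range_one, pow_zero, pow_one, term_moebius_one,
      LSeries.term_of_ne_zero hp.ne_zero, ArithmeticFunction.moebius_apply_prime hp]
    push_cast
    rw [Complex.cpow_neg, div_eq_mul_inv]
    ring
  · intro e he
    have he2 : 2 ≤ e := by rw [Finset.mem_range, not_lt] at he; exact he
    rw [LSeries.term_of_ne_zero (pow_ne_zero e hp.ne_zero),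
      ArithmeticFunction.moebius_apply_prime_pow hp (by omega : e ≠ 0), if_neg (by omega : e ≠ 1)]
    simp

/-- **Euler product of `1/ζ(w) = Σ μ(n)n^{−w}`** (`Re w > 1`): `HasProd (p ↦ 1 − p^{−w}) (ζ(w)⁻¹)`.
[cite: Titchmarsh1986, §1.1] -/
theorem hasProd_one_sub_prime_cpow {w : ℂ} (hw : 1 < w.re) :
    HasProd (fun p : Nat.Primes => 1 - (p : ℂ) ^ (-w)) ((riemannZeta w)⁻¹) := by
  have hsum : LSeriesSummable (fun k : ℕ => ((ArithmeticFunction.moebius k : ℤ) : ℂ)) w :=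
    ArithmeticFunction.LSeriesSummable_moebius_iff.mpr hw
  have h := EulerProduct.eulerProduct_hasProd (term_moebius_one w)
    (fun hmn => term_moebius_mul_of_coprime w hmn) hsum.norm (LSeries.term_zero _ _)
  have hval : ∑' n : ℕ, term (fun k : ℕ => ((ArithmeticFunction.moebius k : ℤ) : ℂ)) w n =
      (riemannZeta w)⁻¹ := by
    have h1 := MeanSquareMajorant.LSeries_moebius_complex hw
    rw [MeanSquareMajorant.coe_moebius_complex] at h1
    exact h1
  have hfun : (fun p : Nat.Primes => ∑' e : ℕ,
      term (fun k : ℕ => ((ArithmeticFunction.moebius k : ℤ) : ℂ)) w (p ^ e)) =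
      fun p : Nat.Primes => 1 - (p : ℂ) ^ (-w) :=
    funext fun p => tsum_term_moebius_prime_pow w p.prop
  rw [hval, hfun] at h
  exact h

/-! ### Assembly: `HasProd (calM2Factor) (ζ(s)L(s,χ)/ζ(s+β₁) · Σ λ̃₂ξ₂ n^{−s})` and the node -/

/-- **The Euler product `∏'_q calM2Factor(q,d,l,s)` converges (as a `HasProd`) to
`ζ(s+β₁)⁻¹·ζ(s)·L(s,χ)·Σ_n λ̃₂(n,d)ξ₂(n;d,l)n^{−s}`** for `σ > 1`. [cite: Zhang2022LandauSiegel, §16 p.91 (u021)] -/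
theorem hasProd_calM2Factor [NeZero D] (d l : ℕ) {s : ℂ} (hs : 1 < s.re) :
    HasProd (fun q : Nat.Primes => calM2Factor c' χ q d l s)
      ((riemannZeta (s + beta1 c' D))⁻¹ * riemannZeta s * LSeries (fun n : ℕ => χ (n : ZMod D)) s *
        ∑' n : ℕ, term (fun n => lamTilde2 c' χ n d * xi2 c' χ n d l) s n) := by
  have hre : 1 < (s + beta1 c' D).re := by
    rw [Complex.add_re, beta1_re c' D, add_zero]; exact hs
  have h3 := hasProd_one_sub_prime_cpow hre
  have h1 := riemannZeta_eulerProduct_hasProd hs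
  have h2 := DirichletCharacter.LSeries_eulerProduct_hasProd χ hs
  have h4 := hasProd_lamTilde2_xi2 c' χ d l hs
  have hfun4 : (fun q : Nat.Primes => ∑' e : ℕ,
      term (fun n => lamTilde2 c' χ n d * xi2 c' χ n d l) s (q ^ e)) =
      fun q : Nat.Primes => 1 + lamTilde2 c' χ q d * xi2LocalSeries c' χ q d l s :=
    funext fun q => tsum_termG_prime_pow c' χ d l hs q.prop
  rw [hfun4] at h4
  have h := ((h3.mul h1).mul h2).mul h4
  have hfun : (fun q : Nat.Primes => calM2Factor c' χ q d l s) = fun q : Nat.Primes =>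
      (1 - (q : ℂ) ^ (-(s + beta1 c' D))) * (1 - (q : ℂ) ^ (-s))⁻¹ *
        (1 - χ (q : ZMod D) * (q : ℂ) ^ (-s))⁻¹ *
        (1 + lamTilde2 c' χ q d * xi2LocalSeries c' χ q d l s) := by
    funext q
    unfold calM2Factor
    rw [div_eq_mul_inv, mul_inv]
    ring
  rw [hfun]
  exact h

/-- **u021 holds** (§16 p.91, tex L4537): for `σ > 1`, `ℳ₂(d,l;s) = ζ(s)L(s,χ)/ζ(s+β₁)·Σ_n λ̃₂(n,d)ξ₂(n;d,l)/n^s`,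
i.e. the typed Euler product `calM2` equals the printed series `calM2Series` on its half-plane of absolute
convergence (every `D`, `χ`, `d`, `l`; no largeness needed). Node `Z22:§16.u021` (identity part) DISCHARGED
(kernel): Euler products of `ζ(s)`, `L(s,χ)` (Mathlib), `1/ζ(s+β₁)` (Möbius) and of the multiplicative
`n ↦ λ̃₂(n,d)ξ₂(n;d,l)` (`step16_u020mult_holds`; absolute convergence from `|λ̃₂ξ₂(n)| ≤ τ(n)⁶` and the
divisor bound), multiplied (`HasProd.mul`). [cite: Zhang2022LandauSiegel, §16 p.91 (u021)] -/
theorem step16_u021_holds : Step16_u021 c' := by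
  refine ⟨0, fun D _ χ _ _ _ d l _ _ s hs => ?_⟩
  have h := hasProd_calM2Factor c' χ d l hs
  unfold calM2
  rw [h.tprod_eq]
  unfold calM2Series
  rw [DirichletCharacter.LFunction_eq_LSeries χ hs]
  have hT : ∑' n : ℕ, term (fun n => lamTilde2 c' χ n d * xi2 c' χ n d l) s n =
      ∑' n : ℕ, lamTilde2 c' χ n d * xi2 c' χ n d l / (n : ℂ) ^ s := by
    refine tsum_congr fun n => ?_
    rcases eq_or_ne n 0 with rfl | hn
    · rw [LSeries.term_zero, xi2_zero, mul_zero, zero_div]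
    · rw [LSeries.term_of_ne_zero hn]
  rw [hT]
  ring

/-- `Step16_u021` — `_holds` alias of `step16_u021_holds` above under the fact's exact name (appended
2026-08-28, D-0026 bookkeeping: the proof term is the existing theorem of this file; no statement,
definition or attribute is edited; no new named fact; the ledger's debt table listed the fact
unproved). [cite: Zhang2022LandauSiegel, §16 p.91 (u021)] -/
theorem _root_.Literature.NumberTheory.LFunctions.Zhang2022.Typed.Section16A.Step16_u021_holds :
    Step16_u021 c' :=
  _root_.Literature.NumberTheory.LFunctions.Zhang2022.Typed.Section16ACalM2.step16_u021_holds (c' := c')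

end EulerM2

end Literature.NumberTheory.LFunctions.Zhang2022.Typed.Section16ACalM2
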